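import Mathlib
import HarnessLib
import Summits.Ventures.LatticeQCDFlow.Exactness.SphereLOFlowAction
import Summits.Ventures.LatticeQCDFlow.Exactness.SphereSiteGreen
import Summits.Ventures.LatticeQCDFlow.Exactness.LatticeSiteResampling

/-!
# Lüscher's operator `−Σ_k ∂̃_k·∂̃_k` on the lattice of site spheres is symmetric and nonnegative (the lattice Green identity)

HONEST FRAMING: exact (Metropolis-corrected) sampling algorithms for lattice gauge theory;
figures of merit are autocorrelation/cost numbers at stated couplings and volumes; no
continuum-physics claim.

Venture `LatticeQCDFlow` (cell pub-lqcd), topic `Exactness`; FANOUT row 7 (`s0-cpn-null`: the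
S0-D1 rung — 2D CP⁹, Lüscher's LO trivializing map inside HMC, Engel–Schaefer 2011).  NEW WORK of
the cell over Mathlib and the tree's `Exactness/SphereLOFlowAction.lean` (E–S's site operators
`siteGrad n` = `∂̃_n`, `siteLaplacian n` = `∂̃_n·∂̃_n`), `Exactness/SphereSiteGreen.lean` (Green's
identity on one site sphere) and `Exactness/LatticeSiteResampling.lean` (redrawing one site of a
product measure); nothing is cited as a fact.  Printed counterpart, NAMED ONLY: M. Lüscher,
Commun. Math. Phys. 293 (2010) 899, §3.2–§3.3 (the differential operator `𝔏₀ = −Σ_{x,μ} ∂ᵃ_{x,μ}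
∂ᵃ_{x,μ}` of the leading-order equation is "symmetric with respect to the scalar product … and
non-negative"; its null space consists of the constant functions — which is what makes the
recursion `𝔏₀ S̃⁽ᵏ⁾ = …` for the trivializing flow action solvable and its solution unique up to
constants, eqs. (3.9)–(3.12)); Engel–Schaefer, Comput. Phys. Commun. 182 (2011) 2107, §3
eq. (15) (the same operator for the CP(N−1)/O(N) site spheres, `−Σ_n ∂̃ⁱ_n∂̃ⁱ_n`).

## Setting

`E` a finite-dimensional real inner product space of dimension `≥ 1`, `Λ` a finite set of sites,
configurations `ω : Λ → S(E)` on the product of unit spheres carrying the product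
`P = ⊗_{n∈Λ} σ` of Mathlib's sphere measures `σ = volume.toSphere`, read in `Λ → E` through the
coercion `n ↦ (ω n : E)`; `F, G : (Λ → E) → ℝ` of class `C²` / `C¹`.

## Content

* `contDiff_update_prod`, `contDiffAt_comp_update_normalize` — the joint site section
  `(x, y) ↦ F(x[k ← y/‖y‖])` is `C^n` off `y = 0`; **`continuousAt_siteGrad`**,
  **`continuousAt_siteLaplacian`** — E–S's site operators of a `C¹`/`C²` function are continuous
  at configurations with `x_k ≠ 0`; `integrable_*` — hence integrable over `P`.
* **`integral_mul_siteLaplacian_eq_neg_integral_inner_siteGrad`** — THE LATTICE GREEN IDENTITY,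
  site by site: `∫ G · ∂̃_k·∂̃_k F dP = −∫ ⟪∂̃_k G, ∂̃_k F⟫ dP` (redraw site `k`, apply the one-sphere
  identity in the fibre, undo).
* **`integral_mul_sum_siteLaplacian`** — summed: `∫ G · (Σ_k ∂̃_k·∂̃_k F) dP = −Σ_k ∫ ⟪∂̃_k G, ∂̃_k F⟫ dP`;
  **`integral_mul_sum_siteLaplacian_comm`** — SYMMETRY `∫ G 𝔏₀F dP = ∫ F 𝔏₀G dP`;
  **`integral_mul_neg_sum_siteLaplacian_self`** — POSITIVITY
  `∫ F · (−Σ_k ∂̃_k·∂̃_k F) dP = Σ_k ∫ ‖∂̃_k F‖² dP ≥ 0` (`…_nonneg`);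
  **`integral_sum_siteLaplacian_eq_zero`** — `∫ Σ_k ∂̃_k·∂̃_k F dP = 0` (range ⟂ constants).

The null space (`𝔏₀F = 0 ⇒ F` constant on the product of spheres) and the resulting uniqueness of
the flow actions `S̃⁽⁰⁾`, `S̃⁽¹⁾` up to constants are `Exactness/SphereLatticeLuscherKernel.lean`.

NOT CLAIMED: essential self-adjointness / spectral theory of `𝔏₀` on `L²(P)` (only the quadratic
form identities on `C²` functions are proved); the spectral gap; anything quantitative.
-/

noncomputable section

namespace Summit.Ventures.LatticeQCDFlow.Exactness

open NormedSpace Function MeasureTheory Metric InnerProductSpace Laplacian Filter Set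
open scoped RealInnerProductSpace Topology Gradient ENNReal

variable {E : Type*} [NormedAddCommGroup E] [InnerProductSpace ℝ E]
variable {Λ : Type*} [Fintype Λ] [DecidableEq Λ]

/-! ## §1 Joint smoothness of the site sections; continuity of the site operators -/

section Smooth

/-- `(x, y) ↦ x[k ← y]` is smooth (it is linear). -/
theorem contDiff_update_prod (k : Λ) {n : WithTop ℕ∞} :
    ContDiff ℝ n (fun p : (Λ → E) × E => update p.1 k p.2) := by
  refine contDiff_pi.2 fun i => ?_
  by_cases hi : i = k
  · subst hi
    simp only [update_self]
    exact contDiff_snd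
  · simp only [update_of_ne hi]
    exact (contDiff_apply ℝ E i).comp contDiff_fst

/-- **The joint site section is `C^n` off the pole**: `(x, y) ↦ F(x[k ← y/‖y‖])` is `C^n` at
every `(x, y)` with `y ≠ 0`, for `F ∈ C^n`. -/
theorem contDiffAt_comp_update_normalize {F : (Λ → E) → ℝ} {n : WithTop ℕ∞} (hF : ContDiff ℝ n F)
    (k : Λ) {p : (Λ → E) × E} (hp : p.2 ≠ 0) :
    ContDiffAt ℝ n (fun q : (Λ → E) × E => F (update q.1 k (normalize q.2))) p := by
  have h1 : ContDiffAt ℝ n (fun q : (Λ → E) × E => (q.1, normalize q.2)) p :=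
    contDiffAt_fst.prodMk ((contDiffAt_normalize hp).comp p contDiffAt_snd)
  exact hF.contDiffAt.comp p ((contDiff_update_prod k).contDiffAt.comp p h1)

/-- The site section `y ↦ F(x[k ← y/‖y‖])` is `C^n` off the origin, for `F ∈ C^n`. -/
theorem contDiffOn_comp_update_normalize {F : (Λ → E) → ℝ} {n : WithTop ℕ∞} (hF : ContDiff ℝ n F)
    (x : Λ → E) (k : Λ) :
    ContDiffOn ℝ n (fun y : E => F (update x k (normalize y))) {0}ᶜ := by
  intro y hy
  have hy0 : y ≠ 0 := hy
  have h := contDiffAt_comp_update_normalize hF k (p := (x, y)) hy0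
  have h2 : ContDiffAt ℝ n (fun y' : E => (x, y')) y := contDiffAt_const.prodMk contDiffAt_id
  exact (h.comp y h2).contDiffWithinAt

/-- The parametric first derivative of the site sections is `C^m` at configurations with
`x_k ≠ 0` (`m + 1 ≤ n`). -/
theorem contDiffAt_fderiv_section {F : (Λ → E) → ℝ} {n m : WithTop ℕ∞} (hF : ContDiff ℝ n F)
    (hmn : m + 1 ≤ n) (k : Λ) {x : Λ → E} (hx : x k ≠ 0) :
    ContDiffAt ℝ m (fun x' : Λ → E =>
      fderiv ℝ (fun y : E => F (update x' k (normalize y))) (x' k)) x := by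
  have h : ContDiffAt ℝ n
      (uncurry fun (x' : Λ → E) (y : E) => F (update x' k (normalize y))) (x, x k) :=
    contDiffAt_comp_update_normalize hF k (p := (x, x k)) hx
  exact h.fderiv (contDiffAt_apply ℝ E k x) hmn

/-- The parametric second derivative of the site sections is continuous (`C⁰`) at configurations
with `x_k ≠ 0`, for `F ∈ C²`. -/
theorem contDiffAt_fderiv_fderiv_section {F : (Λ → E) → ℝ} (hF : ContDiff ℝ 2 F) (k : Λ)
    {x : Λ → E} (hx : x k ≠ 0) :
    ContDiffAt ℝ 0 (fun x' : Λ → E =>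
      fderiv ℝ (fderiv ℝ (fun y : E => F (update x' k (normalize y)))) (x' k)) x := by
  -- the first derivative as a function of (configuration, point)
  have h3 : ContDiffAt ℝ 2 (uncurry fun (p : (Λ → E) × E) (y' : E) =>
      F (update p.1 k (normalize y'))) ((x, x k), x k) := by
    have h := contDiffAt_comp_update_normalize hF k (p := (x, x k)) hx
    have h2 : ContDiffAt ℝ 2 (fun q : ((Λ → E) × E) × E => (q.1.1, q.2)) ((x, x k), x k) :=
      (contDiffAt_fst.comp _ contDiffAt_fst).prodMk contDiffAt_snd
    have h' := h.comp ((x, x k), x k) h2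
    exact h'
  have h2 : ContDiffAt ℝ 1 (uncurry fun (x' : Λ → E) (y : E) =>
      fderiv ℝ (fun y' : E => F (update x' k (normalize y'))) y) (x, x k) :=
    h3.fderiv contDiffAt_snd (by norm_num)
  exact h2.fderiv (contDiffAt_apply ℝ E k x) (by norm_num)

variable [FiniteDimensional ℝ E]

/-- **E–S's site gradient of a `C¹` function is continuous** at configurations with `x_k ≠ 0`. -/
theorem continuousAt_siteGrad {F : (Λ → E) → ℝ} (hF : ContDiff ℝ 1 F) (k : Λ) {x : Λ → E}
    (hx : x k ≠ 0) : ContinuousAt (fun x' => siteGrad k F x') x := by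
  have h := (contDiffAt_fderiv_section hF (m := 0) (by norm_num) k hx).continuousAt
  exact ((toDual ℝ E).symm.continuous.continuousAt).comp h

/-- **E–S's site Laplacian of a `C²` function is continuous** at configurations with `x_k ≠ 0`. -/
theorem continuousAt_siteLaplacian {F : (Λ → E) → ℝ} (hF : ContDiff ℝ 2 F) (k : Λ) {x : Λ → E}
    (hx : x k ≠ 0) : ContinuousAt (fun x' => siteLaplacian k F x') x := by
  set b := stdOrthonormalBasis ℝ E
  have hfun : (fun x' => siteLaplacian k F x') = fun x' => ∑ i,
      fderiv ℝ (fderiv ℝ (fun y : E => F (update x' k (normalize y)))) (x' k) (b i) (b i) := by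
    funext x'
    rw [siteLaplacian, laplacian_eq_iteratedFDeriv_orthonormalBasis _ b]
    simp only [iteratedFDeriv_two_apply, Matrix.cons_val_zero, Matrix.cons_val_one]
  rw [hfun]
  refine (ContDiffAt.sum fun i _ => ?_).continuousAt (𝕜 := ℝ) (n := 0)
  exact ((contDiffAt_fderiv_fderiv_section hF k hx).clm_apply contDiffAt_const).clm_apply
    contDiffAt_const

end Smooth

/-! ## §2 Configurations on the product of unit spheres: continuity and integrability -/

section Config

omit [InnerProductSpace ℝ E] [Fintype Λ] [DecidableEq Λ] in
/-- The coercion of a sphere configuration into `Λ → E` is continuous. -/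
theorem continuous_sphereConfig :
    Continuous fun ω : Λ → sphere (0 : E) 1 => fun n => (ω n : E) :=
  continuous_pi fun n => continuous_subtype_val.comp (continuous_apply n)

omit [InnerProductSpace ℝ E] [Fintype Λ] in
/-- Coercion commutes with updating a site. -/
theorem sphereConfig_update (ω : Λ → sphere (0 : E) 1) (k : Λ) (v : sphere (0 : E) 1) :
    (fun n => ((update ω k v) n : E)) = update (fun n => (ω n : E)) k (v : E) := by
  funext n
  by_cases hn : n = k
  · subst hn; simp
  · simp [update_of_ne hn]

omit [InnerProductSpace ℝ E] [Fintype Λ] [DecidableEq Λ] in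
/-- Every site of a sphere configuration is nonzero. -/
theorem sphereConfig_ne_zero (ω : Λ → sphere (0 : E) 1) (k : Λ) : (ω k : E) ≠ 0 :=
  ne_zero_of_mem_unit_sphere (ω k)

variable [FiniteDimensional ℝ E]

/-- **`ω ↦ ∂̃_k F(ω)` is continuous on the product of unit spheres** (`F ∈ C¹`). -/
theorem continuous_siteGrad_sphereConfig {F : (Λ → E) → ℝ} (hF : ContDiff ℝ 1 F) (k : Λ) :
    Continuous fun ω : Λ → sphere (0 : E) 1 => siteGrad k F (fun n => (ω n : E)) :=
  continuous_iff_continuousAt.2 fun ω =>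
    (continuousAt_siteGrad hF k (sphereConfig_ne_zero ω k)).comp
      continuous_sphereConfig.continuousAt

/-- **`ω ↦ ∂̃_k·∂̃_k F(ω)` is continuous on the product of unit spheres** (`F ∈ C²`). -/
theorem continuous_siteLaplacian_sphereConfig {F : (Λ → E) → ℝ} (hF : ContDiff ℝ 2 F) (k : Λ) :
    Continuous fun ω : Λ → sphere (0 : E) 1 => siteLaplacian k F (fun n => (ω n : E)) :=
  continuous_iff_continuousAt.2 fun ω =>
    (continuousAt_siteLaplacian hF k (sphereConfig_ne_zero ω k)).comp
      continuous_sphereConfig.continuousAt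

/-- `ω ↦ G(ω) · ∂̃_k·∂̃_k F(ω)` is continuous on the product of unit spheres (`F ∈ C²`, `G ∈ C⁰`). -/
theorem continuous_mul_siteLaplacian {F G : (Λ → E) → ℝ} (hF : ContDiff ℝ 2 F) (hG : Continuous G)
    (k : Λ) :
    Continuous fun ω : Λ → sphere (0 : E) 1 =>
      G (fun n => (ω n : E)) * siteLaplacian k F (fun n => (ω n : E)) :=
  (hG.comp continuous_sphereConfig).mul (continuous_siteLaplacian_sphereConfig hF k)

/-- `ω ↦ ⟪∂̃_k G(ω), ∂̃_l F(ω)⟫` is continuous on the product of unit spheres (`F, G ∈ C¹`). -/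
theorem continuous_inner_siteGrad {F G : (Λ → E) → ℝ} (hF : ContDiff ℝ 1 F) (hG : ContDiff ℝ 1 G)
    (k l : Λ) :
    Continuous fun ω : Λ → sphere (0 : E) 1 =>
      ⟪siteGrad k G (fun n => (ω n : E)), siteGrad l F (fun n => (ω n : E))⟫ :=
  (continuous_siteGrad_sphereConfig hG k).inner (continuous_siteGrad_sphereConfig hF l)

variable [MeasurableSpace E] [BorelSpace E]

omit [DecidableEq Λ] in
/-- A continuous function on the (compact) product of unit spheres is integrable for the (finite)
product of sphere measures. -/
theorem integrable_pi_toSphere_of_continuous {h : (Λ → sphere (0 : E) 1) → ℝ} (hh : Continuous h) :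
    Integrable h (Measure.pi fun _ : Λ => (volume : Measure E).toSphere) :=
  hh.integrable_of_hasCompactSupport (HasCompactSupport.of_compactSpace _)

end Config

/-! ## §3 The lattice Green identity -/

section Green

variable [FiniteDimensional ℝ E] [MeasurableSpace E] [BorelSpace E] [Nontrivial E]

/-- Mathlib's sphere measure of a space of positive dimension has nonzero total mass. -/
theorem volume_toSphere_univ_ne_zero : (volume : Measure E).toSphere univ ≠ 0 := by
  rw [Ne, Measure.measure_univ_eq_zero]
  exact Measure.toSphere_ne_zero _

/-- **The fibre identity.**  Redrawing site `k` of a configuration `ω` and integrating over the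
redrawn site: `∫ G·∂̃_k·∂̃_k F (ω[k ← v]) dσ(v) = −∫ ⟪∂̃_k G, ∂̃_k F⟫(ω[k ← v]) dσ(v)` — the one-sphere
Green identity (`SphereSiteGreen`) applied to the site sections `y ↦ F(ω[k ← y/‖y‖])`,
`y ↦ G(ω[k ← y/‖y‖])`, which are degree-`0` extensions of class `C²` / `C¹` off the origin. -/
theorem integral_fibre_mul_siteLaplacian {F G : (Λ → E) → ℝ} (hF : ContDiff ℝ 2 F)
    (hG : ContDiff ℝ 1 G) (k : Λ) (ω : Λ → sphere (0 : E) 1) :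
    ∫ v : sphere (0 : E) 1, G (fun n => ((update ω k v) n : E)) *
        siteLaplacian k F (fun n => ((update ω k v) n : E)) ∂(volume : Measure E).toSphere =
      -∫ v : sphere (0 : E) 1, ⟪siteGrad k G (fun n => ((update ω k v) n : E)),
        siteGrad k F (fun n => ((update ω k v) n : E))⟫ ∂(volume : Measure E).toSphere := by
  have hf : ContDiffOn ℝ 2 (fun y : E => F (update (fun n => (ω n : E)) k (normalize y))) {0}ᶜ :=
    contDiffOn_comp_update_normalize hF _ k
  have hg : ContDiffOn ℝ 1 (fun y : E => G (update (fun n => (ω n : E)) k (normalize y))) {0}ᶜ :=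
    contDiffOn_comp_update_normalize hG _ k
  have hf0 : ∀ y : E, (fun y : E => F (update (fun n => (ω n : E)) k (normalize y))) (normalize y) =
      (fun y : E => F (update (fun n => (ω n : E)) k (normalize y))) y := fun y => by
    simp only [normalize_normalize]
  have key := integral_sphere_mul_laplacian_eq_neg_integral_inner_gradient hf hf0 hg
  -- identify the integrands on the sphere
  have hν : ∀ v : sphere (0 : E) 1, normalize (v : E) = v := fun v =>
    normalize_eq_self_of_norm_eq_one (norm_eq_of_mem_sphere v)
  have hA : ∀ v : sphere (0 : E) 1,
      G (fun n => ((update ω k v) n : E)) * siteLaplacian k F (fun n => ((update ω k v) n : E)) =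
        (fun y : E => G (update (fun n => (ω n : E)) k (normalize y))) v *
          Δ (fun y : E => F (update (fun n => (ω n : E)) k (normalize y))) v := by
    intro v
    rw [sphereConfig_update, siteLaplacian]
    simp only [update_idem, update_self, hν v]
  have hB : ∀ v : sphere (0 : E) 1,
      ⟪siteGrad k G (fun n => ((update ω k v) n : E)), siteGrad k F (fun n => ((update ω k v) n : E))⟫ =
        ⟪∇ (fun y : E => G (update (fun n => (ω n : E)) k (normalize y))) v,
          ∇ (fun y : E => F (update (fun n => (ω n : E)) k (normalize y))) v⟫ := by
    intro v
    rw [sphereConfig_update, siteGrad, siteGrad]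
    simp only [update_idem, update_self]
  simp_rw [hA, hB]
  exact key

/-- **The lattice Green identity, site by site** (Lüscher's `𝔏₀` is symmetric and nonnegative,
one site at a time): for `F ∈ C²`, `G ∈ C¹` and every site `k`,
`∫ G · ∂̃_k·∂̃_k F dP = −∫ ⟪∂̃_k G, ∂̃_k F⟫ dP`, `P = ⊗_n σ` the product of the sphere measures. -/
theorem integral_mul_siteLaplacian_eq_neg_integral_inner_siteGrad {F G : (Λ → E) → ℝ}
    (hF : ContDiff ℝ 2 F) (hG : ContDiff ℝ 1 G) (k : Λ) :
    ∫ ω, G (fun n => (ω n : E)) * siteLaplacian k F (fun n => (ω n : E))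
        ∂Measure.pi (fun _ : Λ => (volume : Measure E).toSphere) =
      -∫ ω, ⟪siteGrad k G (fun n => (ω n : E)), siteGrad k F (fun n => (ω n : E))⟫
        ∂Measure.pi (fun _ : Λ => (volume : Measure E).toSphere) := by
  set σ : Measure (sphere (0 : E) 1) := (volume : Measure E).toSphere with hσ
  have hσ0 : σ univ ≠ 0 := volume_toSphere_univ_ne_zero
  have hσ0' : (σ univ).toReal ≠ 0 := ENNReal.toReal_ne_zero.2 ⟨hσ0, measure_ne_top _ _⟩
  have hA := integrable_pi_toSphere_of_continuous
    (continuous_mul_siteLaplacian hF hG.continuous k)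
  have hB := integrable_pi_toSphere_of_continuous
    (continuous_inner_siteGrad (hF.of_le (by norm_num)) hG k k)
  have h1 : (σ univ).toReal • ∫ ω, G (fun n => (ω n : E)) * siteLaplacian k F (fun n => (ω n : E))
        ∂Measure.pi (fun _ : Λ => σ) =
      ∫ ω, ∫ v, G (fun n => ((update ω k v) n : E)) *
        siteLaplacian k F (fun n => ((update ω k v) n : E)) ∂σ ∂Measure.pi (fun _ : Λ => σ) :=
    integral_pi_eq_integral_integral_update (fun _ : Λ => σ) k hσ0 hA
  have h2 : (σ univ).toReal • ∫ ω, ⟪siteGrad k G (fun n => (ω n : E)),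
        siteGrad k F (fun n => (ω n : E))⟫ ∂Measure.pi (fun _ : Λ => σ) =
      ∫ ω, ∫ v, ⟪siteGrad k G (fun n => ((update ω k v) n : E)),
        siteGrad k F (fun n => ((update ω k v) n : E))⟫ ∂σ ∂Measure.pi (fun _ : Λ => σ) :=
    integral_pi_eq_integral_integral_update (fun _ : Λ => σ) k hσ0 hB
  have hfib : ∀ ω : Λ → sphere (0 : E) 1,
      ∫ v, G (fun n => ((update ω k v) n : E)) * siteLaplacian k F (fun n => ((update ω k v) n : E)) ∂σ =
        -∫ v, ⟪siteGrad k G (fun n => ((update ω k v) n : E)),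
          siteGrad k F (fun n => ((update ω k v) n : E))⟫ ∂σ :=
    fun ω => integral_fibre_mul_siteLaplacian hF hG k ω
  simp_rw [hfib, integral_neg] at h1
  rw [← h2, smul_eq_mul, smul_eq_mul, ← mul_neg] at h1
  exact mul_left_cancel₀ hσ0' h1

/-- **The lattice Green identity, summed over sites**: for `F ∈ C²`, `G ∈ C¹`,
`∫ G · (Σ_k ∂̃_k·∂̃_k F) dP = −Σ_k ∫ ⟪∂̃_k G, ∂̃_k F⟫ dP`. -/
theorem integral_mul_sum_siteLaplacian {F G : (Λ → E) → ℝ} (hF : ContDiff ℝ 2 F)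
    (hG : ContDiff ℝ 1 G) :
    ∫ ω, G (fun n => (ω n : E)) * ∑ k, siteLaplacian k F (fun n => (ω n : E))
        ∂Measure.pi (fun _ : Λ => (volume : Measure E).toSphere) =
      -∑ k, ∫ ω, ⟪siteGrad k G (fun n => (ω n : E)), siteGrad k F (fun n => (ω n : E))⟫
        ∂Measure.pi (fun _ : Λ => (volume : Measure E).toSphere) := by
  simp_rw [Finset.mul_sum]
  rw [integral_finsetSum _ fun k _ =>
    integrable_pi_toSphere_of_continuous (continuous_mul_siteLaplacian hF hG.continuous k)]
  simp_rw [integral_mul_siteLaplacian_eq_neg_integral_inner_siteGrad hF hG]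
  rw [Finset.sum_neg_distrib]

/-- **Symmetry of Lüscher's operator** (`⟨G, 𝔏₀F⟩ = ⟨F, 𝔏₀G⟩` on `C²` functions):
`∫ G · (Σ_k ∂̃_k·∂̃_k F) dP = ∫ F · (Σ_k ∂̃_k·∂̃_k G) dP`. -/
theorem integral_mul_sum_siteLaplacian_comm {F G : (Λ → E) → ℝ} (hF : ContDiff ℝ 2 F)
    (hG : ContDiff ℝ 2 G) :
    ∫ ω, G (fun n => (ω n : E)) * ∑ k, siteLaplacian k F (fun n => (ω n : E))
        ∂Measure.pi (fun _ : Λ => (volume : Measure E).toSphere) =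
      ∫ ω, F (fun n => (ω n : E)) * ∑ k, siteLaplacian k G (fun n => (ω n : E))
        ∂Measure.pi (fun _ : Λ => (volume : Measure E).toSphere) := by
  rw [integral_mul_sum_siteLaplacian hF (hG.of_le (by norm_num)),
    integral_mul_sum_siteLaplacian hG (hF.of_le (by norm_num))]
  simp_rw [real_inner_comm (siteGrad _ F _)]

/-- **Non-negativity of Lüscher's operator, as an energy identity** (`⟨F, 𝔏₀F⟩ = Σ_k ‖∂̃_k F‖²`):
`∫ F · (−Σ_k ∂̃_k·∂̃_k F) dP = Σ_k ∫ ‖∂̃_k F‖² dP`. -/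
theorem integral_mul_neg_sum_siteLaplacian_self {F : (Λ → E) → ℝ} (hF : ContDiff ℝ 2 F) :
    ∫ ω, F (fun n => (ω n : E)) * -∑ k, siteLaplacian k F (fun n => (ω n : E))
        ∂Measure.pi (fun _ : Λ => (volume : Measure E).toSphere) =
      ∑ k, ∫ ω, ‖siteGrad k F (fun n => (ω n : E))‖ ^ 2
        ∂Measure.pi (fun _ : Λ => (volume : Measure E).toSphere) := by
  simp_rw [mul_neg, integral_neg, integral_mul_sum_siteLaplacian hF (hF.of_le (by norm_num)),
    neg_neg, real_inner_self_eq_norm_sq]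

/-- **`𝔏₀ ≥ 0`**: `0 ≤ ∫ F · (−Σ_k ∂̃_k·∂̃_k F) dP` for `F ∈ C²`. -/
theorem integral_mul_neg_sum_siteLaplacian_self_nonneg {F : (Λ → E) → ℝ} (hF : ContDiff ℝ 2 F) :
    0 ≤ ∫ ω, F (fun n => (ω n : E)) * -∑ k, siteLaplacian k F (fun n => (ω n : E))
        ∂Measure.pi (fun _ : Λ => (volume : Measure E).toSphere) := by
  rw [integral_mul_neg_sum_siteLaplacian_self hF]
  exact Finset.sum_nonneg fun k _ => integral_nonneg fun ω => sq_nonneg _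

/-- **The range of `𝔏₀` is orthogonal to the constants**: `∫ Σ_k ∂̃_k·∂̃_k F dP = 0` for
`F ∈ C²` — whence the constants `Ċ` in Lüscher's equations are fixed by taking means
(`SphereLatticeLuscherKernel`). -/
theorem integral_sum_siteLaplacian_eq_zero {F : (Λ → E) → ℝ} (hF : ContDiff ℝ 2 F) :
    ∫ ω, ∑ k, siteLaplacian k F (fun n => (ω n : E))
        ∂Measure.pi (fun _ : Λ => (volume : Measure E).toSphere) = 0 := by
  have h := integral_mul_sum_siteLaplacian hF (G := fun _ => (1 : ℝ)) contDiff_const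
  have h0 : ∀ (k : Λ) (x : Λ → E), siteGrad k (fun _ : Λ → E => (1 : ℝ)) x = 0 := fun k x => by
    rw [siteGrad, gradient, fderiv_const_apply, map_zero]
  simpa [h0] using h

end Green

end Summit.Ventures.LatticeQCDFlow.Exactness

end
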